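import Summits.BirchSwinnertonDyer.Rank1Residual.X11b.Three.GoodReductionSubgroupNodeH1
import Summits.BirchSwinnertonDyer.Rank1Residual.X11b.Three.MultiplicativeMinimalBaseChange
import Literature.NumberTheory.EllipticCurves.SplitNodeQuadraticProofs
import Literature.NumberTheory.EllipticCurves.SingularCubicPointCountProofs
import Mathlib.AlgebraicGeometry.EllipticCurve.Reduction
import Mathlib.FieldTheory.Finite.Basic
import HarnessLib

/-!
# X11b at `p = 3` (team N8/O2), JET3-KUMMER (α), instantiation fact (iii)(a): the NODE
# PRESENTATION `W₀ mod 𝔪 = singularModel x₀ y₀ α₁ α₂` from Mathlib's multiplicative-reduction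
# classes

HONEST FRAMING (cell `b2b-bsdres`, run/shared/lean/b2b/bsd-rank1-residual/, verbatim in every
file): the goal of the cell is to DELETE the COMBINATION-SHAPED residual classes of the
Birch–Swinnerton-Dyer formula for ALL analytic-rank `≤ 1` elliptic curves over `ℚ` — "full BSD
formula for every rank `≤ 1` curve in class `C`" assembled STRICTLY from published theorems — so
that the rank-`≤ 1` remainder becomes exactly the CONSTRUCTION-SHAPED classes, which are TYPED
(missing-input `Prop`s), NOT attempted. This is not "finishing BSD". Team N8/O2 = `x11b3`, seat
`b2b-bsdres-x11b3-p8` (gen 3), LEAD DEAL #6 rows R6-9 / A6.2 (2) / R6-14 (help-wanted): S15 (iii)(a),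
the first of the "standard instantiation facts" of the JET3-KUMMER (α) chain. THEOREMS ONLY: no
definition, no named fact, no `sorry`; nothing is booked; `JET@p|N` NOT discharged.

## What

p4's `h1red_of_node` / `hα_of_h1ker_of_node` / `exists_baseChange_eq_add_pow_smul_of_h1ker_of_node`
(`GoodReductionSubgroupNodeH1`, p253944) take the reduction of the `R`-model `W₀` of `X ⊗ L`
PRESENTED as a node over the residue field `k`:
`hW : W₀.map (IsLocalRing.residue R) = singularModel x₀ y₀ α₁ α₂`, `hα : α₁ ≠ α₂`. This file
derives that presentation from Mathlib's reduction classes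
(`Mathlib.AlgebraicGeometry.EllipticCurve.Reduction`):
* §1 (any local ring `R` with perfect residue field `k`):
  `exists_map_map_residue_eq_singularModel_of_isRoot` — if `W₀ mod 𝔪` is singular with `c̄₄ ≠ 0`
  and Mathlib's splitting quadratic `c₄T² + a₁c₄T − (54b₆ − 3b₂b₄ + a₂c₄)` has a root in a field
  `k' ⊇ k`, then `(W₀ mod 𝔪) ⊗ k' = singularModel (j x₀) (j y₀) α₁ α₂` with `x₀, y₀ ∈ k` (the
  `k`-RATIONAL singular point, tree `exists_singularPoint_of_perfectField`) and slopes
  `α₁ ≠ α₂ ∈ k'` (the form for the NON-SPLIT node, `k'` quadratic over `k`: S15 (ii));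
  `exists_map_residue_eq_singularModel_of_splits` — if the quadratic SPLITS over `k` (Mathlib's
  `HasSplitMultiplicativeReduction` condition) the node is presented over `k` itself;
* §2 (p1's `JetchevKummerAtP` dictionary `X / F`, `L ⊇ F`, DVR `R`, `Frac R = L`,
  `X ⊗ L = W₀ ⊗ L`, `k` finite): `exists_map_residue_eq_singularModel_of_hasSplitMultiplicativeReduction`
  (`∃ x₀ y₀ α₁ α₂, α₁ ≠ α₂ ∧ W₀.map (residue R) = singularModel x₀ y₀ α₁ α₂`) and the `k'`-form
  `exists_map_map_residue_eq_singularModel_of_hasMultiplicativeReduction`;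
* §3 `hasSplitMultiplicativeReduction_baseChange`: along a local homomorphism of DVRs `R₀ → R`
  under `F ⊆ L`, split multiplicative reduction of `X ⊗ F` over `R₀` gives split multiplicative
  reduction of `X ⊗ L` over `R` (twin of p4's `hasMultiplicativeReduction_baseChange`, p252692);
* §4: p4's three theorems with `hW`, `hα` DISCHARGED from
  `[(X.baseChange L).HasSplitMultiplicativeReduction R]`; the remaining binders `hR` (Galois
  stability of `R`), `hcard`/`hfrob` (`#k = qⁿ`, `φ` lifts `x ↦ x^q`) and the formal-group stub
  `h1ker` are carried BY NAME, unchanged.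

Mechanism (Silverman *AEC* III.1.4(a), III.2.5, VII.§5 "split: the slopes of the tangent lines at
the node are in `k`"): `V := W₀ mod 𝔪` has `Δ = 0`, `c₄ ≠ 0`, a `k`-rational singular point
`(x₀, y₀)`; over `k̄'` the tangent cone splits, `V ⊗ k̄' = singularModel x₀ y₀ β₁ β₂` (tree
`eq_singularModel`), so Mathlib's quadratic is `c̄₄ (T − β₁)(T − β₂)` (tree
`map_map_splittingQuadratic_eq_of_eq_singularModel`); a root in `k'` is one slope, the other is
`−ā₁ −` it; `α₁ ≠ α₂` from `c̄₄ = (α₁ − α₂)⁴ ≠ 0`. No new fact. References (locators only):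
[cite: SilvermanAEC2009, Prop. III.1.4(a), Prop. III.2.5, VII.§5 (PDF pp. 51, 59, 174)].

## Design

No definitions; `noncomputable section`; `open scoped Classical`; the quadratic is written
verbatim as in Mathlib's class field and the tree's `SplitNodeQuadraticProofs`. Axioms:
`propext`, `Classical.choice`, `Quot.sound`.
-/

noncomputable section

open scoped Classical

namespace Summit.BirchSwinnertonDyer.Rank1Residual.X11b.Three.JetchevKummer

open WeierstrassCurve Literature.NumberTheory.EllipticCurves Polynomial

universe u
/-! ### §1 Node presentation over a local ring with perfect residue field -/

section LocalRing

variable {R : Type*} [CommRing R] [IsLocalRing R] [PerfectField (IsLocalRing.ResidueField R)]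
  (W₀ : WeierstrassCurve R)

/-- **Node presentation over an extension `k'` of the residue field containing a slope.** For
a local ring `R` with perfect residue field `k` and `W₀` over `R` with `Δ̄ = 0`, `c̄₄ ≠ 0` (a node),
if Mathlib's splitting quadratic `c₄T² + a₁c₄T − (54b₆ − 3b₂b₄ + a₂c₄) mod 𝔪` has a root in a
field `k' ⊇ k` (`j : k → k'`), then `(W₀ mod 𝔪) ⊗ k' = singularModel (j x₀) (j y₀) α₁ α₂` for the
`k`-rational singular point `(x₀, y₀)` and tangent slopes `α₁ ≠ α₂ ∈ k'`.
[cite: SilvermanAEC2009, Prop. III.1.4(a), Prop. III.2.5, VII.§5 (PDF pp. 51, 59, 174)] -/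
theorem exists_map_map_residue_eq_singularModel_of_isRoot
    (hΔ : IsLocalRing.residue R W₀.Δ = 0) (hc₄ : IsLocalRing.residue R W₀.c₄ ≠ 0)
    {k' : Type*} [Field k'] (j : IsLocalRing.ResidueField R →+* k') {α : k'}
    (hroot : (((C W₀.c₄ * X ^ 2 + C (W₀.a₁ * W₀.c₄) * X -
        C (54 * W₀.b₆ - 3 * W₀.b₂ * W₀.b₄ + W₀.a₂ * W₀.c₄)).map
          (algebraMap R (IsLocalRing.ResidueField R))).map j).IsRoot α) :
    ∃ x₀ y₀ : IsLocalRing.ResidueField R, ∃ α₁ α₂ : k', α₁ ≠ α₂ ∧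
      (W₀.map (IsLocalRing.residue R)).map j = singularModel (j x₀) (j y₀) α₁ α₂ := by
  set V := W₀.map (IsLocalRing.residue R) with hVdef
  have hVΔ : V.Δ = 0 := by rw [hVdef, map_Δ, hΔ]
  -- the `k`-rational singular point
  obtain ⟨x₀, y₀, hE, hX, hY⟩ := V.exists_singularPoint_of_perfectField hVΔ
  -- slopes over an algebraic closure of `k'`
  set kb := AlgebraicClosure k'
  set ι : k' →+* kb := algebraMap k' kb with hιdef
  set Vb := V.map (ι.comp j) with hVbdef
  have hEb : Vb.toAffine.Equation ((ι.comp j) x₀) ((ι.comp j) y₀) :=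
    (Affine.map_equation V (ι.comp j).injective x₀ y₀).mpr hE
  have hXb : Vb.a₁ * (ι.comp j) y₀ =
      3 * (ι.comp j) x₀ ^ 2 + 2 * Vb.a₂ * (ι.comp j) x₀ + Vb.a₄ := by
    simp only [hVbdef, map_a₁, map_a₂, map_a₄, ← map_mul, ← map_pow, ← map_ofNat (ι.comp j),
      ← map_add, hX]
  have hYb : 2 * (ι.comp j) y₀ + Vb.a₁ * (ι.comp j) x₀ + Vb.a₃ = 0 := by
    simp only [hVbdef, map_a₁, map_a₃, ← map_mul, ← map_ofNat (ι.comp j), ← map_add, hY, map_zero]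
  obtain ⟨β₁, β₂, hs, hp⟩ := Vb.exists_tangentSlopes ((ι.comp j) x₀)
  have hmodel : (W₀.map (IsLocalRing.residue R)).map (ι.comp j) =
      singularModel ((ι.comp j) x₀) ((ι.comp j) y₀) β₁ β₂ := Vb.eq_singularModel hEb hXb hYb hs hp
  -- Mathlib's quadratic over `kb` is `c̄₄ (T - β₁)(T - β₂)`
  have hQ := map_map_splittingQuadratic_eq_of_eq_singularModel W₀ (ι.comp j) hmodel
  have hcb : (ι.comp j) (IsLocalRing.residue R W₀.c₄) ≠ 0 := (_root_.map_ne_zero _).mpr hc₄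
  -- the given root `α ∈ k'` is a slope
  have hαroot : ι α = β₁ ∨ ι α = β₂ := by
    have h1 : ((((C W₀.c₄ * X ^ 2 + C (W₀.a₁ * W₀.c₄) * X -
        C (54 * W₀.b₆ - 3 * W₀.b₂ * W₀.b₄ + W₀.a₂ * W₀.c₄)).map
          (algebraMap R (IsLocalRing.ResidueField R))).map j).map ι).IsRoot (ι α) :=
      hroot.map (f := ι)
    rw [Polynomial.map_map, hQ, IsRoot.def] at h1
    simp only [eval_mul, eval_C, eval_sub, eval_X] at h1
    rcases mul_eq_zero.mp h1 with h | h
    · exact (hcb h).elim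
    · rcases mul_eq_zero.mp h with h | h
      · exact Or.inl (sub_eq_zero.mp h)
      · exact Or.inr (sub_eq_zero.mp h)
  -- both slopes lie in `k'`: the other one is `-ā₁ - α`
  have ha₁ : Vb.a₁ = ι (j V.a₁) := by rw [hVbdef, map_a₁, RingHom.comp_apply]
  obtain ⟨α₁, α₂, h₁, h₂⟩ : ∃ α₁ α₂ : k', ι α₁ = β₁ ∧ ι α₂ = β₂ := by
    rcases hαroot with h | h
    · refine ⟨α, -(j V.a₁) - α, h, ?_⟩
      rw [map_sub, map_neg, ← ha₁, h]; linear_combination -hs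
    · refine ⟨-(j V.a₁) - α, α, ?_, h⟩
      rw [map_sub, map_neg, ← ha₁, h]; linear_combination -hs
  refine ⟨x₀, y₀, α₁, α₂, ?_, ?_⟩
  · -- `α₁ ≠ α₂` from `c̄₄ = (β₁ - β₂)⁴ ≠ 0`
    rintro rfl
    apply hcb
    have : ((W₀.map (IsLocalRing.residue R)).map (ι.comp j)).c₄ = 0 := by
      rw [hmodel, singularModel.c₄_eq, ← h₁, ← h₂, sub_self, zero_pow four_ne_zero]
    rwa [map_c₄, map_c₄] at this
  · have key : ((W₀.map (IsLocalRing.residue R)).map j).map ι =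
        (singularModel (j x₀) (j y₀) α₁ α₂).map ι := by
      rw [WeierstrassCurve.map_map, hmodel, singularModel.map_eq, h₁, h₂]
      try rfl
    exact WeierstrassCurve.map_injective ι.injective key

/-- **Node presentation over the residue field at a SPLIT node.** If, with `R`, `W₀`, `Δ̄ = 0`,
`c̄₄ ≠ 0` as above, Mathlib's splitting quadratic SPLITS over the residue field `k` (the condition
of `WeierstrassCurve.HasSplitMultiplicativeReduction`), then
`W₀ mod 𝔪 = singularModel x₀ y₀ α₁ α₂` with `x₀, y₀, α₁ ≠ α₂` all in `k` — literally the
hypotheses `hW`, `hα` of `h1red_of_node` (Silverman, *AEC*, VII.§5: "split if the slopes of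
the tangent lines at the node are in `k`"). [cite: SilvermanAEC2009, VII.§5 (PDF p. 174)] -/
theorem exists_map_residue_eq_singularModel_of_splits
    (hΔ : IsLocalRing.residue R W₀.Δ = 0) (hc₄ : IsLocalRing.residue R W₀.c₄ ≠ 0)
    (hsplit : ((C W₀.c₄ * X ^ 2 + C (W₀.a₁ * W₀.c₄) * X -
        C (54 * W₀.b₆ - 3 * W₀.b₂ * W₀.b₄ + W₀.a₂ * W₀.c₄)).map
          (algebraMap R (IsLocalRing.ResidueField R))).Splits) :
    ∃ x₀ y₀ α₁ α₂ : IsLocalRing.ResidueField R, α₁ ≠ α₂ ∧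
      W₀.map (IsLocalRing.residue R) = singularModel x₀ y₀ α₁ α₂ := by
  set Q := (C W₀.c₄ * X ^ 2 + C (W₀.a₁ * W₀.c₄) * X -
      C (54 * W₀.b₆ - 3 * W₀.b₂ * W₀.b₄ + W₀.a₂ * W₀.c₄)).map
        (algebraMap R (IsLocalRing.ResidueField R)) with hQdef
  -- the quadratic has degree `2` (leading coefficient `c̄₄ ≠ 0`), hence a root in `k`
  have hc : algebraMap R (IsLocalRing.ResidueField R) W₀.c₄ ≠ 0 := by
    rwa [IsLocalRing.ResidueField.algebraMap_eq]
  have hdeg : Q.degree ≠ 0 := by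
    have h2 : Q.coeff 2 = algebraMap R (IsLocalRing.ResidueField R) W₀.c₄ := by
      simp only [hQdef, Polynomial.map_sub, Polynomial.map_add, Polynomial.map_mul,
        Polynomial.map_pow, map_C, map_X, coeff_sub, coeff_add, coeff_C_mul, coeff_X_pow,
        coeff_C, coeff_X, if_true]
      norm_num
    intro h0
    have hle : Q.degree < 2 := by rw [h0]; exact_mod_cast two_pos
    have := coeff_eq_zero_of_degree_lt hle
    exact hc (h2 ▸ this)
  obtain ⟨α, hα⟩ := hsplit.exists_eval_eq_zero hdeg
  have hroot : (Q.map (RingHom.id _)).IsRoot α := by rw [Polynomial.map_id]; exact hα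
  obtain ⟨x₀, y₀, α₁, α₂, hne, hmodel⟩ :=
    exists_map_map_residue_eq_singularModel_of_isRoot W₀ hΔ hc₄ (RingHom.id _) hroot
  refine ⟨x₀, y₀, α₁, α₂, hne, ?_⟩
  rwa [WeierstrassCurve.map_id] at hmodel

end LocalRing
/-! ### §2 In p1's dictionary: from Mathlib's reduction classes of `X ⊗ L` over `R` -/

section Dictionary

variable {F : Type u} [Field F] (X : WeierstrassCurve F) (L : Type u) [Field L] [Algebra F L]
  (R : Type*) [CommRing R] [IsDomain R] [IsDiscreteValuationRing R] [Algebra R L]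
  [IsFractionRing R L] (W₀ : WeierstrassCurve R) (hX : X.baseChange L = W₀.baseChange L)

include hX in
/-- At a multiplicative place the `R`-model reduces to a singular cubic with `c̄₄ ≠ 0`
(Mathlib's `HasMultiplicativeReduction`: `v(Δ) < 1`, `v(c₄) = 1`, read on `W₀ = integralModel`).
[folklore] -/
theorem residue_Δ_eq_zero_and_residue_c₄_ne_zero_of_hasMultiplicativeReduction
    [h : (X.baseChange L).HasMultiplicativeReduction R] :
    IsLocalRing.residue R W₀.Δ = 0 ∧ IsLocalRing.residue R W₀.c₄ ≠ 0 := by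
  have hI : (X.baseChange L).integralModel R = W₀ := integralModel_eq_of_baseChange_eq X L R W₀ hX
  have hΔ := h.badReduction
  have hc := h.multiplicativeReduction
  rw [← integralModel_Δ_eq R (X.baseChange L), hI,
    valuation_algebraMap_lt_one_iff_not_isUnit] at hΔ
  rw [← integralModel_c₄_eq R (X.baseChange L), hI, valuation_algebraMap_eq_one_iff_isUnit] at hc
  refine ⟨(IsLocalRing.residue_eq_zero_iff _).mpr ((IsLocalRing.mem_maximalIdeal _).mpr hΔ),
    fun h0 ↦ ?_⟩
  exact (IsLocalRing.mem_maximalIdeal _).mp ((IsLocalRing.residue_eq_zero_iff _).mp h0) hc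

include hX in
/-- **Node presentation from `HasSplitMultiplicativeReduction`** (p1's dictionary, `k` finite):
if `X ⊗ L` has split multiplicative reduction over `R` then its `R`-model reduces to a node
PRESENTED OVER `k`: `W₀ mod 𝔪 = singularModel x₀ y₀ α₁ α₂`, `α₁ ≠ α₂` — the hypotheses `hW`, `hα`
of `h1red_of_node` / `hα_of_h1ker_of_node`. Silverman, *AEC*, VII.§5.
[cite: SilvermanAEC2009, VII.§5 (PDF p. 174), Prop. III.1.4(a)] -/
theorem exists_map_residue_eq_singularModel_of_hasSplitMultiplicativeReduction
    [Finite (IsLocalRing.ResidueField R)] [h : (X.baseChange L).HasSplitMultiplicativeReduction R] :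
    ∃ x₀ y₀ α₁ α₂ : IsLocalRing.ResidueField R, α₁ ≠ α₂ ∧
      W₀.map (IsLocalRing.residue R) = singularModel x₀ y₀ α₁ α₂ := by
  haveI : PerfectField (IsLocalRing.ResidueField R) := PerfectField.ofFinite
  have hI : (X.baseChange L).integralModel R = W₀ := integralModel_eq_of_baseChange_eq X L R W₀ hX
  obtain ⟨hΔ, hc⟩ :=
    residue_Δ_eq_zero_and_residue_c₄_ne_zero_of_hasMultiplicativeReduction X L R W₀ hX
  have hsplit := h.splitMultiplicativeReduction
  rw [hI] at hsplit
  exact exists_map_residue_eq_singularModel_of_splits W₀ hΔ hc hsplit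

include hX in
/-- **Node presentation from `HasMultiplicativeReduction`, over an extension `k'` of the residue
field containing a root of the splitting quadratic** (the form for the NON-SPLIT node, `k'` the
quadratic extension of `k`): `(W₀ mod 𝔪) ⊗ k' = singularModel (j x₀) (j y₀) α₁ α₂` with the
singular point `(x₀, y₀)` rational over `k` and slopes `α₁ ≠ α₂ ∈ k'`.
[cite: SilvermanAEC2009, VII.§5 (PDF p. 174), Prop. III.1.4(a)] -/
theorem exists_map_map_residue_eq_singularModel_of_hasMultiplicativeReduction
    [Finite (IsLocalRing.ResidueField R)] [(X.baseChange L).HasMultiplicativeReduction R]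
    {k' : Type*} [Field k'] (j : IsLocalRing.ResidueField R →+* k') {α : k'}
    (hroot : (((C W₀.c₄ * Polynomial.X ^ 2 + C (W₀.a₁ * W₀.c₄) * Polynomial.X -
        C (54 * W₀.b₆ - 3 * W₀.b₂ * W₀.b₄ + W₀.a₂ * W₀.c₄)).map
          (algebraMap R (IsLocalRing.ResidueField R))).map j).IsRoot α) :
    ∃ x₀ y₀ : IsLocalRing.ResidueField R, ∃ α₁ α₂ : k', α₁ ≠ α₂ ∧
      (W₀.map (IsLocalRing.residue R)).map j = singularModel (j x₀) (j y₀) α₁ α₂ := by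
  haveI : PerfectField (IsLocalRing.ResidueField R) := PerfectField.ofFinite
  obtain ⟨hΔ, hc⟩ :=
    residue_Δ_eq_zero_and_residue_c₄_ne_zero_of_hasMultiplicativeReduction X L R W₀ hX
  exact exists_map_map_residue_eq_singularModel_of_isRoot W₀ hΔ hc j hroot

end Dictionary
/-! ### §3 Split multiplicative reduction is stable under `R₀ → R` -/

section BaseChange

variable {F : Type u} [Field F] (X : WeierstrassCurve F) (L : Type u) [Field L] [Algebra F L]
  (R₀ : Type*) [CommRing R₀] [IsDomain R₀] [IsDiscreteValuationRing R₀] [Algebra R₀ F]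
  [IsFractionRing R₀ F]
  (R : Type*) [CommRing R] [IsDomain R] [IsDiscreteValuationRing R] [Algebra R L]
  [IsFractionRing R L]
  [Algebra R₀ R] [Algebra R₀ L] [IsScalarTower R₀ R L] [IsScalarTower R₀ F L]

/-- **Silverman, *AEC* Prop. VII.5.4 (b), split multiplicative case.** Along a local
homomorphism of discrete valuation rings `R₀ → R` under `F ⊆ L`: if `X ⊗ F` has SPLIT
multiplicative reduction over `R₀` then `X ⊗ L` has split multiplicative reduction over `R`
(the equation stays minimal and multiplicative — p4's `hasMultiplicativeReduction_baseChange` —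
and Mathlib's splitting quadratic over `k` is the image of the one over `k₀`, so it still splits).
[cite: SilvermanAEC2009, Prop. VII.5.4 (b) (PDF p. 175), VII.§5] -/
theorem hasSplitMultiplicativeReduction_baseChange [IsLocalHom (algebraMap R₀ R)]
    [h : (X.baseChange F).HasSplitMultiplicativeReduction R₀] :
    (X.baseChange L).HasSplitMultiplicativeReduction R := by
  haveI hm : (X.baseChange L).HasMultiplicativeReduction R :=
    hasMultiplicativeReduction_baseChange X L R₀ R
  refine { toHasMultiplicativeReduction := hm, splitMultiplicativeReduction := ?_ }
  set I₀ := (X.baseChange F).integralModel R₀ with hI₀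
  have hI : (X.baseChange L).integralModel R = I₀.map (algebraMap R₀ R) :=
    integralModel_baseChange_eq_map X L R₀ R
  have hc : (algebraMap R (IsLocalRing.ResidueField R)).comp (algebraMap R₀ R) =
      (IsLocalRing.ResidueField.map (algebraMap R₀ R)).comp
        (algebraMap R₀ (IsLocalRing.ResidueField R₀)) := by
    rw [IsLocalRing.ResidueField.algebraMap_eq, IsLocalRing.ResidueField.algebraMap_eq]
    exact RingHom.ext fun r ↦ (IsLocalRing.ResidueField.map_residue (algebraMap R₀ R) r).symm
  have hs := (h.splitMultiplicativeReduction).map (IsLocalRing.ResidueField.map (algebraMap R₀ R))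
  rw [Polynomial.map_map, ← hc, ← Polynomial.map_map] at hs
  -- the quadratic of `I₀ ⊗ R` is the image of the quadratic of `I₀`
  have hQ : (C (I₀.map (algebraMap R₀ R)).c₄ * Polynomial.X ^ 2 +
      C ((I₀.map (algebraMap R₀ R)).a₁ * (I₀.map (algebraMap R₀ R)).c₄) * Polynomial.X -
      C (54 * (I₀.map (algebraMap R₀ R)).b₆ -
        3 * (I₀.map (algebraMap R₀ R)).b₂ * (I₀.map (algebraMap R₀ R)).b₄ +
        (I₀.map (algebraMap R₀ R)).a₂ * (I₀.map (algebraMap R₀ R)).c₄) : R[X]) =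
      (C I₀.c₄ * Polynomial.X ^ 2 + C (I₀.a₁ * I₀.c₄) * Polynomial.X -
        C (54 * I₀.b₆ - 3 * I₀.b₂ * I₀.b₄ + I₀.a₂ * I₀.c₄)).map (algebraMap R₀ R) := by
    simp only [map_c₄, map_a₁, map_a₂, map_b₂, map_b₄, map_b₆, Polynomial.map_sub,
      Polynomial.map_add, Polynomial.map_mul, Polynomial.map_pow, map_C, map_X, map_mul, map_sub,
      map_add, map_ofNat, Polynomial.map_ofNat]
  rw [hI, hQ]
  exact hs

end BaseChange
/-! ### §4 p4's node theorems with the presentation discharged -/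

section Discharge

variable {F : Type u} [Field F] (X : WeierstrassCurve F) (L : Type u) [Field L] [Algebra F L]
  (R : Type*) [CommRing R] [IsDomain R] [IsDiscreteValuationRing R] [Algebra R L]
  [IsFractionRing R L] [(X.baseChange L).HasSplitMultiplicativeReduction R]
  [HenselianRing R (IsLocalRing.maximalIdeal R)] [Finite (IsLocalRing.ResidueField R)]
  (W₀ : WeierstrassCurve R) (hX : X.baseChange L = W₀.baseChange L)

include hX in
/-- **The `Ẽ_ns` half of (α) at a SPLIT multiplicative place** — p4's `h1red_of_node` with
`hW`/`hα` discharged from `[(X.baseChange L).HasSplitMultiplicativeReduction R]` (§2); remaining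
binders `hR`, `hcard`, `hfrob` by name. [cite: SilvermanAEC2009, VII.2 Prop. 2.1, VII.§5,
Exercise 3.5(a)] [cite: SerreLocalFields1979, X §1 (Hilbert 90)] -/
theorem h1red_of_hasSplitMultiplicativeReduction
    (hR : ∀ (τ : L ≃ₐ[F] L) (x : L), x ∈ Set.range (algebraMap R L) →
      τ x ∈ Set.range (algebraMap R L))
    (φ : L ≃ₐ[F] L) {q n : ℕ} (hcard : Nat.card (IsLocalRing.ResidueField R) = q ^ n)
    (hfrob : ∀ a : R, ∃ a' : R, algebraMap R L a' = φ (algebraMap R L a) ∧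
      IsLocalRing.residue R a' = IsLocalRing.residue R a ^ q) :
    ∀ m ∈ (X.baseChange L).goodReductionSubgroup R, ∑ j ∈ Finset.range n, (φ ^ j) • m = 0 →
      ∃ c ∈ (X.baseChange L).goodReductionSubgroup R, m - (φ • c - c) ∈
        {Q : (X.baseChange L).toAffine.Point | ∀ (x y : L)
          (h : (X.baseChange L).toAffine.Nonsingular x y), Q = .some x y h →
            x ∉ Set.range (algebraMap R L)} := by
  obtain ⟨_, _, _, _, hα, hW⟩ :=
    exists_map_residue_eq_singularModel_of_hasSplitMultiplicativeReduction X L R W₀ hX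
  exact h1red_of_node X L R W₀ hX hR hW hα φ hcard hfrob

include hX in
/-- **(α) from the formal-group stub alone, at a SPLIT multiplicative place** — p4's
`hα_of_h1ker_of_node` with `hW`/`hα` discharged; remaining binders `hR`, `hφ`, `hn`, `hcard`,
`hfrob` and the NAMED STUB `h1ker` (Milne *ADT* I.3.8 proof). [cite: MilneADT2006, Ch. I Prop. 3.8]
[cite: SilvermanAEC2009, VII.2 Prop. 2.1, VII.§5, Exercise 3.5(a)] -/
theorem hα_of_h1ker_of_hasSplitMultiplicativeReduction
    (hR : ∀ (τ : L ≃ₐ[F] L) (x : L), x ∈ Set.range (algebraMap R L) →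
      τ x ∈ Set.range (algebraMap R L))
    (φ : L ≃ₐ[F] L) (hφ : ∀ σ : L ≃ₐ[F] L, σ ∈ Subgroup.zpowers φ) {q n : ℕ} (hn : φ ^ n = 1)
    (hcard : Nat.card (IsLocalRing.ResidueField R) = q ^ n)
    (hfrob : ∀ a : R, ∃ a' : R, algebraMap R L a' = φ (algebraMap R L a) ∧
      IsLocalRing.residue R a' = IsLocalRing.residue R a ^ q)
    (h1ker : ∀ m ∈ {Q : (X.baseChange L).toAffine.Point | ∀ (x y : L)
        (h : (X.baseChange L).toAffine.Nonsingular x y), Q = .some x y h →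
          x ∉ Set.range (algebraMap R L)},
      ∑ j ∈ Finset.range n, (φ ^ j) • m = 0 →
        ∃ P ∈ {Q : (X.baseChange L).toAffine.Point | ∀ (x y : L)
          (h : (X.baseChange L).toAffine.Nonsingular x y), Q = .some x y h →
            x ∉ Set.range (algebraMap R L)}, φ • P - P = m) :
    ∀ Q : (X.baseChange L).toAffine.Point,
      (∀ σ : L ≃ₐ[F] L, σ • Q - Q ∈ (X.baseChange L).goodReductionSubgroup R) →
        ∃ Q' : (X.baseChange L).toAffine.Point, (∀ σ : L ≃ₐ[F] L, σ • Q' = Q') ∧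
          Q - Q' ∈ (X.baseChange L).goodReductionSubgroup R := by
  obtain ⟨_, _, _, _, hα, hW⟩ :=
    exists_map_residue_eq_singularModel_of_hasSplitMultiplicativeReduction X L R W₀ hX
  exact hα_of_h1ker_of_node X L R W₀ hX hR hW hα φ hφ hn hcard hfrob h1ker

include hX in
/-- **End form at `v` from the formal-group stub alone, at a SPLIT multiplicative place** —
p4's `exists_baseChange_eq_add_pow_smul_of_h1ker_of_node` with `hW`/`hα` discharged:
`T = ι(t₀ + p^m t₁)`, `t₀ ∈ E₀(K_v)` (Jetchev Prop. 4.1 at `v`) modulo (a), (b), the cocycle,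
`hR`/`hφ`/`hn`/`hcard`/`hfrob` and the ONE stub `h1ker`. [cite: Jetchev2008, Prop. 4.1 (p. 819)] -/
theorem exists_baseChange_eq_add_pow_smul_of_h1ker_of_hasSplitMultiplicativeReduction
    [IsGalois F L]
    (R₀ : Type*) [CommRing R₀] [IsDomain R₀] [IsDiscreteValuationRing R₀] [Algebra R₀ F]
    [IsFractionRing R₀ F] [Algebra R₀ R] [Algebra R₀ L] [IsScalarTower R₀ R L]
    [IsScalarTower R₀ F L] [IsLocalHom (algebraMap R₀ R)] [(X.baseChange F).IsMinimal R₀]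
    (hR : ∀ (τ : L ≃ₐ[F] L) (x : L), x ∈ Set.range (algebraMap R L) →
      τ x ∈ Set.range (algebraMap R L))
    (φ : L ≃ₐ[F] L) (hφ : ∀ σ : L ≃ₐ[F] L, σ ∈ Subgroup.zpowers φ) {q n : ℕ} (hn : φ ^ n = 1)
    (hcard : Nat.card (IsLocalRing.ResidueField R) = q ^ n)
    (hfrob : ∀ a : R, ∃ a' : R, algebraMap R L a' = φ (algebraMap R L a) ∧
      IsLocalRing.residue R a' = IsLocalRing.residue R a ^ q)
    (h1ker : ∀ m ∈ {Q : (X.baseChange L).toAffine.Point | ∀ (x y : L)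
        (h : (X.baseChange L).toAffine.Nonsingular x y), Q = .some x y h →
          x ∉ Set.range (algebraMap R L)},
      ∑ j ∈ Finset.range n, (φ ^ j) • m = 0 →
        ∃ P ∈ {Q : (X.baseChange L).toAffine.Point | ∀ (x y : L)
          (h : (X.baseChange L).toAffine.Nonsingular x y), Q = .some x y h →
            x ∉ Set.range (algebraMap R L)}, φ • P - P = m)
    {p m n' : ℕ} (hcop : Nat.Coprime n' (p ^ m)) {U P T : (X.baseChange L).toAffine.Point}
    {Rσ : (L ≃ₐ[F] L) → (X.baseChange L).toAffine.Point}
    (hT : ∀ σ : L ≃ₐ[F] L, σ • T = T)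
    (hP : (n' : ℤ) • P ∈ (X.baseChange L).goodReductionSubgroup R)
    (hRσ : ∀ σ : L ≃ₐ[F] L, (n' : ℤ) • Rσ σ ∈ (X.baseChange L).goodReductionSubgroup R)
    (hU : ∀ σ : L ≃ₐ[F] L, σ • U - U = Rσ σ) (hpU : ((p ^ m : ℕ) : ℤ) • U = P - T) :
    ∃ t₀ t₁ : (X.baseChange F).toAffine.Point,
      t₀ ∈ (X.baseChange F).goodReductionSubgroup R₀ ∧
      T = Affine.Point.baseChange (W' := X.toAffine) F L (t₀ + ((p ^ m : ℕ) : ℤ) • t₁) := by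
  obtain ⟨_, _, _, _, hα, hW⟩ :=
    exists_map_residue_eq_singularModel_of_hasSplitMultiplicativeReduction X L R W₀ hX
  exact exists_baseChange_eq_add_pow_smul_of_h1ker_of_node X L R W₀ hX R₀ hR hW hα φ hφ hn hcard
    hfrob h1ker hcop hT hP hRσ hU hpU

end Discharge

end Summit.BirchSwinnertonDyer.Rank1Residual.X11b.Three.JetchevKummer

end
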